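import Mathlib.Tactic

/-!
# Route «KPlusLogSqLaw», crux `TropicalB` (stmt-ValiantsHypothesis-19771) — CALIBRATION: a 4-CYCLE of pairwise couplings carries a
# CUBIC convex chain (the sum-of-squares certificate)

HONEST FRAMING.  Calibration file of the object-search cell `pub-symmetroid` (seat val-sym-trop-p5 g4, refuter-adjacent lane) for the crux
`Summit.ValiantsHypothesis.ValiantsHypothesis.Theses.KPlusLogSqLaw.TropicalB` (ledger item `stmt-ValiantsHypothesis-19771`), landed
`--supports … --as helper`.  It is PURE ARITHMETIC about integer quadruples — no dominance design occurs — and asserts nothing about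
`TropicalB`, `WeakLifting`, `KPlusLogSqLaw`, `MatrixDescartes` (stmt-ValiantsHypothesis-18050) or `VP ≠ VNP`.  It records, in the kernel, the
positive half of the seat's memo ARCHITECTURE.md (§3), against which the companion file `…TropicalBPathCoupling` (paths are quadratic) is read.

THE POINT.  Abstract a register design as digits `x = (x₁, x₂, x₃, x₄)`, slope `s = w·x`, valuation `V = Σ_edges f_e` over a factor graph `H`.
`…TropicalBPathCoupling.card_family_le`: for `H` a PATH on three digits every dominant chain meets the family in `O(r²)` terms.  Here: for `H` the
4-CYCLE `{12, 23, 34, 41}` no such ceiling exists at the level of convex position —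
* `FourCycle.sq_add_sq_eq_edges` — if `w₁w₃ = w₂w₄ = ν` then `(w·x)² + ν(x₁+x₄−x₂−x₃)²` is a sum of FOUR functions of the edge pairs
  `(x₁,x₂), (x₂,x₃), (x₃,x₄), (x₄,x₁)` (the two non-edge cross terms cancel exactly);
* `FourCycle.sq_le`, `FourCycle.eq_iff` — it is `≥ (w·x)²`, with equality iff `x₁ + x₄ = x₂ + x₃` (for `ν > 0`);
* `FourCycle.injOn` — for `w = (1+t, 1, t, t(1+t))` (so `ν = t(1+t)`; these are the consecutive differences of the `K = 4` exponents
  `d = (0, 1, 1+t, (1+t)²)`) and `t ≥ 3r`, the slope `w·x` is INJECTIVE on `S = {x ∈ [0,r)⁴ : x₁ + x₄ = x₂ + x₃}`.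
Consequently every point of `S` (≈ `2r³/3` of them) is a vertex of the lower hull of `{(w·x, V(x)) : x ∈ [0,r)⁴}` (points on a parabola with
distinct abscissae; all other points strictly above): a 4-cycle of PAIRWISE couplings carries a CUBIC convex chain, so the «registers meet
additively» rows of the cell are a property of factor graphs of degree ≤ 2, not of pairwise coupling.  Whether a 4-cycle is realisable by a
dominance design with long digits is exactly what the memo's landing-swap analysis (§4–§5) denies for shared-track registers; nothing is claimed
here about realisability. [folklore: completing the square; the packaging is the cell's]
-/

set_option linter.dupNamespace false
set_option autoImplicit false

namespace Summit.ValiantsHypothesis.ValiantsHypothesis.Theorems.KPlusLogSqLaw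

namespace FourCycle

/-- **EDGE DECOMPOSITION.**  With `w₁w₃ = w₂w₄ = ν`, the form `(w·x)² + ν(x₁+x₄−x₂−x₃)²` is a sum of four functions of consecutive pairs
around the 4-cycle `1–2–3–4–1`; the `(1,3)` and `(2,4)` cross terms cancel. [folklore] -/
theorem sq_add_sq_eq_edges (w₁ w₂ w₃ w₄ ν : ℤ) (h13 : w₁ * w₃ = ν) (h24 : w₂ * w₄ = ν) (x₁ x₂ x₃ x₄ : ℤ) :
    (w₁ * x₁ + w₂ * x₂ + w₃ * x₃ + w₄ * x₄) ^ 2 + ν * (x₁ + x₄ - x₂ - x₃) ^ 2 =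
      ((w₁ ^ 2 + ν) * x₁ ^ 2 + 2 * (w₁ * w₂ - ν) * x₁ * x₂) +
      ((w₂ ^ 2 + ν) * x₂ ^ 2 + 2 * (w₂ * w₃ + ν) * x₂ * x₃) +
      ((w₃ ^ 2 + ν) * x₃ ^ 2 + 2 * (w₃ * w₄ - ν) * x₃ * x₄) +
      ((w₄ ^ 2 + ν) * x₄ ^ 2 + 2 * (w₄ * w₁ + ν) * x₄ * x₁) := by
  linear_combination (2 * x₁ * x₃) * h13 + (2 * x₂ * x₄) * h24

/-- the certificate is a lower bound by the bare square … [folklore] -/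
theorem sq_le (w₁ w₂ w₃ w₄ ν : ℤ) (hν : 0 ≤ ν) (x₁ x₂ x₃ x₄ : ℤ) :
    (w₁ * x₁ + w₂ * x₂ + w₃ * x₃ + w₄ * x₄) ^ 2 ≤
      (w₁ * x₁ + w₂ * x₂ + w₃ * x₃ + w₄ * x₄) ^ 2 + ν * (x₁ + x₄ - x₂ - x₃) ^ 2 :=
  le_add_of_nonneg_right (mul_nonneg hν (sq_nonneg _))

/-- … with equality exactly on `S = {x₁ + x₄ = x₂ + x₃}` (for `ν > 0`); off `S` the excess is at least `ν`. [folklore] -/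
theorem eq_iff (w₁ w₂ w₃ w₄ ν : ℤ) (hν : 0 < ν) (x₁ x₂ x₃ x₄ : ℤ) :
    (w₁ * x₁ + w₂ * x₂ + w₃ * x₃ + w₄ * x₄) ^ 2 + ν * (x₁ + x₄ - x₂ - x₃) ^ 2 =
      (w₁ * x₁ + w₂ * x₂ + w₃ * x₃ + w₄ * x₄) ^ 2 ↔ x₁ + x₄ = x₂ + x₃ := by
  constructor
  · intro h
    have h0 : ν * (x₁ + x₄ - x₂ - x₃) ^ 2 = 0 := by linarith
    rcases mul_eq_zero.mp h0 with h1 | h1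
    · exact absurd h1 hν.ne'
    · have := pow_eq_zero_iff (n := 2) (by norm_num) |>.mp h1
      linarith
  · intro h
    have : x₁ + x₄ - x₂ - x₃ = 0 := by linarith
    rw [this]; ring

/-- off `S` the excess over the square is at least `ν`. [folklore] -/
theorem le_of_ne (w₁ w₂ w₃ w₄ ν : ℤ) (hν : 0 ≤ ν) (x₁ x₂ x₃ x₄ : ℤ) (h : x₁ + x₄ ≠ x₂ + x₃) :
    (w₁ * x₁ + w₂ * x₂ + w₃ * x₃ + w₄ * x₄) ^ 2 + ν ≤
      (w₁ * x₁ + w₂ * x₂ + w₃ * x₃ + w₄ * x₄) ^ 2 + ν * (x₁ + x₄ - x₂ - x₃) ^ 2 := by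
  have hδ : x₁ + x₄ - x₂ - x₃ ≠ 0 := fun h0 => h (by linarith)
  have h1 : 1 ≤ (x₁ + x₄ - x₂ - x₃) ^ 2 := by
    rcases lt_or_gt_of_ne hδ with hlt | hgt
    · nlinarith
    · nlinarith
  nlinarith

/-- **THE `K = 4` WEIGHTS.**  `w = (1+t, 1, t, t(1+t))` — the consecutive differences of the exponents `d = (0, 1, 1+t, (1+t)²)` — satisfy
`w₁w₃ = w₂w₄ = t(1+t)`. [folklore] -/
theorem weights (t : ℤ) : (1 + t) * t = t * (1 + t) ∧ (1 : ℤ) * (t * (1 + t)) = t * (1 + t) := by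
  constructor <;> ring

/-- on `S` (substituting `x₄ = x₂ + x₃ − x₁`) the slope is `(1 − t²)x₁ + (t² + t + 1)x₂ + (t² + 2t)x₃`. [folklore] -/
theorem slope_on_S (t x₁ x₂ x₃ : ℤ) :
    (1 + t) * x₁ + 1 * x₂ + t * x₃ + t * (1 + t) * (x₂ + x₃ - x₁) =
      (1 - t ^ 2) * x₁ + (t ^ 2 + t + 1) * x₂ + (t ^ 2 + 2 * t) * x₃ := by
  ring

/-- **INJECTIVITY ON `S`.**  For `t ≥ 3r` (`r ≥ 1`) the slope `(1+t)x₁ + x₂ + t x₃ + t(1+t)x₄` takes pairwise distinct values on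
`S = {x ∈ [0,r)⁴ : x₁ + x₄ = x₂ + x₃}`: writing the difference as `t²·P + t·Q + R` with `|Q| < 3r`, `|R| < 2r` forces `P = Q = R = 0`.
[folklore] -/
theorem injOn (r t : ℤ) (hr : 1 ≤ r) (ht : 3 * r ≤ t) (x₁ x₂ x₃ x₄ y₁ y₂ y₃ y₄ : ℤ)
    (hx₁ : 0 ≤ x₁) (hx₁' : x₁ < r) (hx₂ : 0 ≤ x₂) (hx₂' : x₂ < r) (hx₃ : 0 ≤ x₃) (hx₃' : x₃ < r)
    (hy₁ : 0 ≤ y₁) (hy₁' : y₁ < r) (hy₂ : 0 ≤ y₂) (hy₂' : y₂ < r) (hy₃ : 0 ≤ y₃) (hy₃' : y₃ < r)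
    (hSx : x₁ + x₄ = x₂ + x₃) (hSy : y₁ + y₄ = y₂ + y₃)
    (hs : (1 + t) * x₁ + 1 * x₂ + t * x₃ + t * (1 + t) * x₄ = (1 + t) * y₁ + 1 * y₂ + t * y₃ + t * (1 + t) * y₄) :
    x₁ = y₁ ∧ x₂ = y₂ ∧ x₃ = y₃ ∧ x₄ = y₄ := by
  -- differences
  set a := x₁ - y₁ with ha
  set b := x₂ - y₂ with hb
  set c := x₃ - y₃ with hc
  have hx₄ : x₄ = x₂ + x₃ - x₁ := by linarith
  have hy₄ : y₄ = y₂ + y₃ - y₁ := by linarith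
  -- the relation t²·P + t·Q + R = 0 with P = -a+b+c, Q = b+2c, R = a+b
  have key : t ^ 2 * (-a + b + c) + t * (b + 2 * c) + (a + b) = 0 := by
    rw [hx₄, hy₄] at hs
    have : (1 - t ^ 2) * x₁ + (t ^ 2 + t + 1) * x₂ + (t ^ 2 + 2 * t) * x₃ =
        (1 - t ^ 2) * y₁ + (t ^ 2 + t + 1) * y₂ + (t ^ 2 + 2 * t) * y₃ := by
      rw [← slope_on_S, ← slope_on_S]; exact hs
    rw [ha, hb, hc]; linarith
  have hab : -r < a ∧ a < r := ⟨by linarith, by linarith⟩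
  have hbb : -r < b ∧ b < r := ⟨by linarith, by linarith⟩
  have hcb : -r < c ∧ c < r := ⟨by linarith, by linarith⟩
  have ht0 : 0 < t := by linarith
  have htt : t * (3 * r) ≤ t * t := mul_le_mul_of_nonneg_left ht ht0.le
  have hsq : t ^ 2 = t * t := by ring
  -- P = 0
  have hP : -a + b + c = 0 := by
    by_contra hP
    rcases lt_or_gt_of_ne hP with hneg | hpos
    · have h1 : t ^ 2 * (-a + b + c) ≤ t ^ 2 * (-1) :=
        mul_le_mul_of_nonneg_left (by linarith) (sq_nonneg t)
      have h2 : t * (b + 2 * c) ≤ t * (3 * r - 3) := mul_le_mul_of_nonneg_left (by linarith) ht0.le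
      have h3 : a + b ≤ 2 * r - 2 := by linarith
      rw [hsq] at h1 key
      linarith
    · have h1 : t ^ 2 * 1 ≤ t ^ 2 * (-a + b + c) :=
        mul_le_mul_of_nonneg_left (by linarith) (sq_nonneg t)
      have h2 : t * (-(3 * r) + 3) ≤ t * (b + 2 * c) := mul_le_mul_of_nonneg_left (by linarith) ht0.le
      have h3 : -(2 * r) + 2 ≤ a + b := by linarith
      rw [hsq] at h1 key
      linarith
  have key2 : t * (b + 2 * c) + (a + b) = 0 := by
    have : t ^ 2 * (-a + b + c) = 0 := by rw [hP]; ring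
    linarith
  -- Q = 0
  have hQ : b + 2 * c = 0 := by
    by_contra hQ
    rcases lt_or_gt_of_ne hQ with hneg | hpos
    · have h1 : t * (b + 2 * c) ≤ t * (-1) := mul_le_mul_of_nonneg_left (by linarith) ht0.le
      have h3 : a + b ≤ 2 * r - 2 := by linarith
      linarith
    · have h1 : t * 1 ≤ t * (b + 2 * c) := mul_le_mul_of_nonneg_left (by linarith) ht0.le
      have h3 : -(2 * r) + 2 ≤ a + b := by linarith
      linarith
  have hR : a + b = 0 := by
    have : t * (b + 2 * c) = 0 := by rw [hQ]; ring
    linarith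
  have hc0 : c = 0 := by linarith
  have hb0 : b = 0 := by linarith
  have ha0 : a = 0 := by linarith
  refine ⟨by linarith, by linarith, by linarith, ?_⟩
  rw [hx₄, hy₄]; linarith

end FourCycle

end Summit.ValiantsHypothesis.ValiantsHypothesis.Theorems.KPlusLogSqLaw
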